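import Mathlib.Data.Rat.Defs
import Mathlib.Algebra.Order.Field.Rat
import Mathlib.Tactic
import HarnessLib

/-!
# ζ(5) search — kernel-checkable positivity of polynomial inequalities `∀ n ≥ N` (cell `pub-zeta5`, TYPER)

HONEST FRAMING: systematic search; no irrationality claim unless certified.

The recurrence-first certificate (FORMAT A, `ApproximationCertificate.lean`, tools in
`RecurrenceGrowth.lean`) asks for finitely many inequalities between rational functions of `n`,
valid for all `n ≥ N` — e.g. `λ + t n/λ ≤ s n` with `s = P₁/P₂`, `t = P₀/P₂`, i.e.
`λ P₁(n) - λ² P₂(n) - P₀(n) ≥ 0` after clearing the (positive) denominator. This file gives the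
standard SUFFICIENT criterion that makes such a claim a finite computation the kernel can check:
a polynomial with rational coefficients is `≥ 0` on `[N, ∞)` as soon as all coefficients of its
Taylor shift `p(y + N)` are `≥ 0`. Polynomials are COEFFICIENT LISTS `[a₀, a₁, …]` (constant term
first) with Horner evaluation, so that every function here is computable over `ℚ` and the
hypothesis `∀ a ∈ taylorShift N l, 0 ≤ a` is discharged on concrete data by
`norm_num [taylorShift, addCoeffs, smulCoeffs]` (tested: degree 3, `N = 13/2`; plain `decide` gets
stuck on `ℚ` arithmetic in the kernel, do not use it).

* `hornerEval l x` — `a₀ + x (a₁ + x (a₂ + …))`;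
* `taylorShift N l` — the coefficient list of `y ↦ p(y + N)`; `hornerEval_taylorShift`;
* `hornerEval_nonneg_of_coeff_nonneg` — nonnegative coefficients ⇒ `p(x) ≥ 0` for `x ≥ 0`;
* `hornerEval_nonneg_of_taylorShift_nonneg` — **the criterion**: coefficients of `p(y+N)` all
  `≥ 0` ⇒ `p(x) ≥ 0` for all rational `x ≥ N` (in particular all integers `n ≥ N`);
* `hornerEval_pos_of_taylorShift` — strict version (constant coefficient of the shift `> 0`).

Everything is PROVED; the definitions are computable list recursions (no `Polynomial` API needed
by users). Pure algebra, no `ζ`-specific input.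
-/

namespace Summit.KontsevichZagierPeriods.Zeta5Search

/-- Horner evaluation of a coefficient list `[a₀, a₁, a₂, …]` (constant term first) at `x`:
`a₀ + x · (a₁ + x · (a₂ + …))`. -/
def hornerEval : List ℚ → ℚ → ℚ
  | [], _ => 0
  | a :: l, x => a + x * hornerEval l x

/-- Coefficientwise sum of two coefficient lists (the longer tail is kept). -/
def addCoeffs : List ℚ → List ℚ → List ℚ
  | [], l => l
  | l, [] => l
  | a :: l, b :: m => (a + b) :: addCoeffs l m

/-- Scalar multiple of a coefficient list. -/
def smulCoeffs (c : ℚ) : List ℚ → List ℚ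
  | [] => []
  | a :: l => (c * a) :: smulCoeffs c l

/-- The coefficient list of the Taylor shift `y ↦ p(y + N)` of `p = [a₀, a₁, …]`:
`p(y+N) = a₀ + (y + N) · q(y + N)` for `p = a₀ + x q(x)`. -/
def taylorShift (N : ℚ) : List ℚ → List ℚ
  | [] => []
  | a :: l => addCoeffs [a] (addCoeffs (smulCoeffs N (taylorShift N l)) (0 :: taylorShift N l))

/-- The empty coefficient list evaluates to `0`. -/
@[simp] theorem hornerEval_nil (x : ℚ) : hornerEval [] x = 0 := rfl

/-- Horner step: `(a :: l)(x) = a + x · l(x)`. -/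
@[simp] theorem hornerEval_cons (a : ℚ) (l : List ℚ) (x : ℚ) :
    hornerEval (a :: l) x = a + x * hornerEval l x := rfl

/-- `addCoeffs` adds the evaluations. -/
theorem hornerEval_addCoeffs (l m : List ℚ) (x : ℚ) :
    hornerEval (addCoeffs l m) x = hornerEval l x + hornerEval m x := by
  induction l generalizing m with
  | nil => simp [addCoeffs]
  | cons a l ih =>
    cases m with
    | nil => simp [addCoeffs]
    | cons b m => simp [addCoeffs, ih]; ring

/-- `smulCoeffs` scales the evaluation. -/
theorem hornerEval_smulCoeffs (c : ℚ) (l : List ℚ) (x : ℚ) :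
    hornerEval (smulCoeffs c l) x = c * hornerEval l x := by
  induction l with
  | nil => simp [smulCoeffs]
  | cons a l ih => simp [smulCoeffs, ih]; ring

/-- **The Taylor shift evaluates as it should**: `(taylorShift N p)(y) = p(y + N)`. -/
theorem hornerEval_taylorShift (N : ℚ) (l : List ℚ) (y : ℚ) :
    hornerEval (taylorShift N l) y = hornerEval l (y + N) := by
  induction l with
  | nil => simp [taylorShift]
  | cons a l ih =>
    simp only [taylorShift, hornerEval_addCoeffs, hornerEval_smulCoeffs, hornerEval_cons,
      hornerEval_nil, ih]
    ring

/-- Nonnegative coefficients give a nonnegative value at every `x ≥ 0`. -/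
theorem hornerEval_nonneg_of_coeff_nonneg (l : List ℚ) (h : ∀ a ∈ l, 0 ≤ a) (x : ℚ)
    (hx : 0 ≤ x) : 0 ≤ hornerEval l x := by
  induction l with
  | nil => simp
  | cons a l ih =>
    rw [hornerEval_cons]
    have ha : 0 ≤ a := h a (by simp)
    have hl : 0 ≤ hornerEval l x := ih fun b hb => h b (by simp [hb])
    positivity

/-- **Positivity on `[N, ∞)` by shifted coefficients** (the certification criterion): if every
coefficient of `p(y + N)` is `≥ 0` then `p(x) ≥ 0` for all rational `x ≥ N`. The hypothesis is a
finite check on concrete data (`norm_num [taylorShift, addCoeffs, smulCoeffs]`). -/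
theorem hornerEval_nonneg_of_taylorShift_nonneg (l : List ℚ) (N : ℚ)
    (h : ∀ a ∈ taylorShift N l, 0 ≤ a) (x : ℚ) (hx : N ≤ x) : 0 ≤ hornerEval l x := by
  have h1 := hornerEval_nonneg_of_coeff_nonneg (taylorShift N l) h (x - N) (by linarith)
  rw [hornerEval_taylorShift] at h1
  simpa using h1

/-- **Strict positivity on `[N, ∞)`**: if every coefficient of `p(y + N)` is `≥ 0` and its
constant coefficient (`= p(N)`) is `> 0`, then `p(x) > 0` for all rational `x ≥ N`. -/
theorem hornerEval_pos_of_taylorShift (a₀ : ℚ) (m : List ℚ) (l : List ℚ) (N : ℚ)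
    (hshift : taylorShift N l = a₀ :: m) (h0 : 0 < a₀) (h : ∀ a ∈ m, 0 ≤ a) (x : ℚ)
    (hx : N ≤ x) : 0 < hornerEval l x := by
  have h1 : hornerEval l x = hornerEval (taylorShift N l) (x - N) := by
    rw [hornerEval_taylorShift]; simp
  rw [h1, hshift, hornerEval_cons]
  have h2 : 0 ≤ hornerEval m (x - N) := hornerEval_nonneg_of_coeff_nonneg m h (x - N) (by linarith)
  have h3 : 0 ≤ x - N := by linarith
  positivity

/-- Integer arguments: the criterion specialised to `n : ℕ` with `N ≤ n` (how the recurrence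
inequalities `∀ n ≥ N` of `RecurrenceGrowth.ratio_bounds_of_recurrence` are discharged). -/
theorem hornerEval_natCast_nonneg_of_taylorShift_nonneg (l : List ℚ) (N : ℕ)
    (h : ∀ a ∈ taylorShift N l, 0 ≤ a) (n : ℕ) (hn : N ≤ n) : 0 ≤ hornerEval l n :=
  hornerEval_nonneg_of_taylorShift_nonneg l N h n (by exact_mod_cast hn)

end Summit.KontsevichZagierPeriods.Zeta5Search
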